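import Summits.CriticalPhenomena.CardyFormulaZ2.Theorems.CardyFlipRussoVoronoiHubFromSmirnovGraphDefs

/-!
# Stub `graphCross_pivotal_recolour` of line `moebius-exact-delaunay-dilation-ward`
# (crux `VoronoiHubFromSmirnov`, stmt-CriticalPhenomena-6433, route `CardyFlipRusso`)

**Pivotality of the recolouring set** (S3b-i deterministic core; Benjamini–Schramm,
*Conformal invariance of Voronoi percolation*, Comm. Math. Phys. 197 (1998), §9, display (9.1)).
Compare, for the SAME nuclei `c = (black, white)`, the Euclidean graph crossing event `graphCross`
and the pulled-back one `hGraphCross`.  Let `Z` be a set of configuration-coordinate positions such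
that every pair of black nuclei, physically inside `K` and BOTH outside `Z`, has the same adjacency
in the two senses.  If `c ∈ graphCross` but `c ∉ hGraphCross`, then `Z` is pivotal for the
Euclidean event:

* recolouring every nucleus in `Z` black, `c⁺ = (c.1 ∪ c.2|Z, c.2|Zᶜ)`, keeps the crossing: the
  black chain of `c` is a chain of `c⁺.1 ⊇ c.1` and the set of ALL sites is unchanged
  (`pr_sites_black`), so the adjacency clause is literally the same;
* recolouring every nucleus in `Z` white, `c⁻ = (c.1|Zᶜ, c.2 ∪ c.1|Z)`, kills it: the set of all
  sites is again unchanged (`pr_sites_white`); a black chain of `c⁻` consists of nuclei of `c.1`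
  outside `Z`, physically in `K`, so by the hypothesis its consecutive pairs are `h`-adjacent and the
  same chain would witness `c ∈ hGraphCross`.

Pure logic and set algebra on the carriers (`PointConfig.carrier_union`,
`PointConfig.carrier_restrict`); no new definitions.
-/

noncomputable section

namespace Summit.CriticalPhenomena.CardyFormulaZ2.Cruxes.VoronoiHubFromSmirnov.MoebiusExactDelaunayDilationWard

open Set Literature.Analysis.FunctionSpaces Literature.Probability.RandomPlanarGeometry
open Literature.Probability.LatticeModels (IsDelaunayPair)

/-- Recolouring the nuclei in `Z` black does not change the set of all sites:
`(c.1 ∪ c.2|Z) ∪ c.2|Zᶜ = c.1 ∪ c.2` as sets. -/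
theorem pr_sites_black (Z : Set ℂ) (c : PointConfig ℂ × PointConfig ℂ) :
    ((c.1 ∪ PointConfig.restrict Z c.2 : PointConfig ℂ) : Set ℂ) ∪
        ((PointConfig.restrict Zᶜ c.2 : PointConfig ℂ) : Set ℂ) =
      (c.1 : Set ℂ) ∪ (c.2 : Set ℂ) := by
  ext x
  simp only [PointConfig.coe_eq_carrier, PointConfig.carrier_union, PointConfig.carrier_restrict,
    Set.mem_union, Set.mem_inter_iff, Set.mem_compl_iff]
  tauto

/-- Recolouring the nuclei in `Z` white does not change the set of all sites:
`c.1|Zᶜ ∪ (c.2 ∪ c.1|Z) = c.1 ∪ c.2` as sets. -/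
theorem pr_sites_white (Z : Set ℂ) (c : PointConfig ℂ × PointConfig ℂ) :
    ((PointConfig.restrict Zᶜ c.1 : PointConfig ℂ) : Set ℂ) ∪
        ((c.2 ∪ PointConfig.restrict Z c.1 : PointConfig ℂ) : Set ℂ) =
      (c.1 : Set ℂ) ∪ (c.2 : Set ℂ) := by
  ext x
  simp only [PointConfig.coe_eq_carrier, PointConfig.carrier_union, PointConfig.carrier_restrict,
    Set.mem_union, Set.mem_inter_iff, Set.mem_compl_iff]
  tauto

/-- A nucleus of the restricted configuration `c|s` is a nucleus of `c` lying in `s`. -/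
theorem pr_mem_restrict {s : Set ℂ} {c : PointConfig ℂ} {x : ℂ} (hx : x ∈ PointConfig.restrict s c) :
    x ∈ c ∧ x ∈ s :=
  hx

/-- **Pivotality of the recolouring set** (Benjamini–Schramm 1998, §9 (9.1), deterministic core of
S3b-i): if the Euclidean and the pulled-back graph crossing events disagree in the direction
`c ∈ graphCross`, `c ∉ hGraphCross`, and every pair of black nuclei physically in `K` with both
endpoints outside `Z` has agreeing adjacency in the two senses, then recolouring all nuclei in `Z`
black keeps the Euclidean graph crossing while recolouring them white destroys it. -/
theorem graphCross_pivotal_recolour : ∀ (K A₀ A₂ : Set ℂ) (h : ℂ → ℂ) (V Z : Set ℂ) (δ : ℝ) (c : Literature.Analysis.FunctionSpaces.PointConfig ℂ × Literature.Analysis.FunctionSpaces.PointConfig ℂ), (∀ p ∈ (c.1 : Set ℂ), ∀ q ∈ (c.1 : Set ℂ), (δ : ℂ) * p ∈ K → (δ : ℂ) * q ∈ K → p ∉ Z → q ∉ Z → (Literature.Probability.LatticeModels.IsDelaunayPair ((c.1 : Set ℂ) ∪ (c.2 : Set ℂ)) p q ↔ Literature.Probability.LatticeModels.IsDelaunayPair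 (transportSet h V δ c.1 ∪ transportSet h V δ c.2) (transportMap h δ p) (transportMap h δ q))) → c ∈ graphCross K A₀ A₂ δ → c ∉ hGraphCross K A₀ A₂ h V δ → (c.1 ∪ Literature.Analysis.FunctionSpaces.PointConfig.restrict Z c.2, Literature.Analysis.FunctionSpaces.PointConfig.restrict Zᶜ c.2) ∈ graphCross K A₀ A₂ δ ∧ (Literature.Analysis.FunctionSpaces.PointConfig.restrict Zᶜ c.1, c.2 ∪ Literature.Analysis.FunctionSpaces.PointConfig.restrict Z c.1) ∉ graphCross K A₀ A₂ δ := by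
  intro K A₀ A₂ h V Z δ c hagree hc hnot
  obtain ⟨N, p, hp1, hpK, hp0, hpN, hadj⟩ := hc
  refine ⟨⟨N, p, fun i => PointConfig.mem_union.2 (Or.inl (hp1 i)), hpK, hp0, hpN, fun i => ?_⟩,
    ?_⟩
  · -- all-black recolouring: the set of all sites is unchanged
    show IsDelaunayPair (((c.1 ∪ PointConfig.restrict Z c.2 : PointConfig ℂ) : Set ℂ) ∪
      ((PointConfig.restrict Zᶜ c.2 : PointConfig ℂ) : Set ℂ)) (p i.castSucc) (p i.succ)
    rw [pr_sites_black]
    exact hadj i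
  · -- all-white recolouring: a surviving black chain would be an `h`-chain of `c`
    rintro ⟨M, q, hq1, hqK, hq0, hqM, hqadj⟩
    refine hnot ⟨M, q, fun i => (pr_mem_restrict (hq1 i)).1, hqK, hq0, hqM, fun i => ?_⟩
    have hqa := pr_mem_restrict (hq1 i.castSucc)
    have hqb := pr_mem_restrict (hq1 i.succ)
    have e : IsDelaunayPair (((PointConfig.restrict Zᶜ c.1 : PointConfig ℂ) : Set ℂ) ∪
        ((c.2 ∪ PointConfig.restrict Z c.1 : PointConfig ℂ) : Set ℂ)) (q i.castSucc) (q i.succ) :=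
      hqadj i
    rw [pr_sites_white] at e
    exact (hagree _ hqa.1 _ hqb.1 (hqK _) (hqK _) hqa.2 hqb.2).1 e

end Summit.CriticalPhenomena.CardyFormulaZ2.Cruxes.VoronoiHubFromSmirnov.MoebiusExactDelaunayDilationWard

end
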